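import Summits.NavierStokesRegularity.FluidComputer.ClayBlowupSingularSliceHausdorffOneForced
import Summits.NavierStokesRegularity.FluidComputer.DesignedBlowupSymmetry
import Literature.Analysis.FluidPDE.AxisymmetricSingularSetOnAxis
import HarnessLib

/-!
# AN AXISYMMETRIC CLAY BLOW-UP BLOWS UP FIRST ON THE AXIS: its singular slice is a nonempty compact
# `ℋ¹`-null subset of the symmetry axis

Cell `ns-blowup`, seat `ns-blowup-ecbridge-2` (g7; the E–C endpoint theory seat). LABEL: E–C typing
(KERNEL — no named fact). WHAT THIS IS NOT: not Navier–Stokes evidence — a necessary condition on the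
TYPES `ClayBlowup ν` / `DesignedBlowup ν` with axisymmetric datum and force (no inhabitant is claimed
anywhere). Companion memo: `run/shared/lean/pub/ns-blowup/ecbridge2/ECBRIDGE-2-MEMO-6.md` §2.

## Content (Caffarelli–Kohn–Nirenberg's circle argument at the first blow-up time, with the Clay force)

The classical corollary of CKN's Theorem B for axisymmetric flows — "all singular points must belong
to the axis of symmetry" (Seregin–Šverák 2009, §3; in the tree for INTERIOR points of suitable weak
solutions: `singularSet_subset_axis`, `AxisymmetricSingularSetOnAxis.lean`) — at the FIRST BLOW-UP TIME
of a Clay / designed blow-up whose datum and force are axisymmetric: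

* `hausdorffMeasure_rotZ_arc_pos_space` — a spatial orbit arc `{R_θ x₀ : |θ| < δ}` off the axis has
  positive `ℋ¹`-measure in `ℝ³` (the tree's space–time version `hausdorffMeasure_rotZ_arc_pos`
  transported along the isometric embedding `x ↦ (t₀, x)` of `ℝ³` into `ℝ × ℝ³`);
* `ClayBlowup.isBackwardBoundedAt_rotZ` — backward boundedness at `(T, x₀)` rotates with the
  symmetry: the slices `u t`, `0 ≤ t < T`, are axisymmetric (`DesignedBlowup.isAxisymmetric`, the lean
  lineage's heredity theorem, via `toDesignedBlowup`), and `|u(t, x)| = |u(t, R_{-θ} x)|`;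
* **`ClayBlowup.cylRadius_eq_zero_of_not_isBackwardBoundedAt`** — a singular point of the final slice
  lies ON THE AXIS: otherwise its orbit arc, made of singular points, would have positive `ℋ¹`-measure,
  against `hausdorffMeasure_one_singularSlice_eq_zero` (`μH[1] S_T = 0`, this seat, forced case);
* `ClayBlowup.singularSlice_subset_axis`, `ClayBlowup.exists_singularPoint_on_axis` (there IS a
  singular point and it is on the axis, inside `B̄(0, R)`), `ClayBlowup.isBackwardBoundedAt_of_cylRadius_ne_zero`
  (every point off the axis is backward bounded at `T`: the blow-up is invisible off the axis up to
  and including the blow-up time), and the `DesignedBlowup` twins.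

References: L. Caffarelli, R. Kohn, L. Nirenberg, CPAM 35 (1982), Theorem B, §6
[cite: CaffarelliKohnNirenberg1982, Theorem B]; G. Seregin, V. Šverák, Comm. PDE 34 (2009) = arXiv:0804.1803,
§3 p. 9 [cite: SereginSverak2009, §3]; G. Seregin, Anal. Math. Phys. 10 (2020), proof of Thm. 2.1
[cite: Seregin2020, §2]; C. L. Fefferman, Clay problem description, (A), (C) [cite: FeffermanClay2006, (C)].
-/

noncomputable section

namespace Summit.NavierStokesRegularity.FluidComputer

open Set MeasureTheory Filter Topology Function TopologicalSpace Metric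
open scoped ENNReal NNReal
open Literature.Analysis.FluidPDE
open Summit.NavierStokesRegularity.NavierStokesRegularity
open Summit.NavierStokesRegularity.FluidComputer.PalasekTowerClayBridge

/-! ## §1 A spatial orbit arc off the axis has positive `ℋ¹`-measure -/

/-- **A spatial orbit arc off the axis has positive one-dimensional Hausdorff measure**: for `x₀` with
`cylRadius x₀ ≠ 0` and `δ > 0`, `0 < μH[1] {R_θ x₀ : -δ < θ < δ}` in `ℝ³`. The tree's space–time
statement `hausdorffMeasure_rotZ_arc_pos` (the arc `{(t₀, R_θ x₀)}` in `ℝ × ℝ³`) transported along the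
isometric embedding `x ↦ (t₀, x)` (sup product metric; isometries preserve `μH[1]`).
[cite: SereginSverak2009, §3 (arXiv p. 9)] -/
theorem hausdorffMeasure_rotZ_arc_pos_space {x₀ : EuclideanSpace ℝ (Fin 3)} (hx : cylRadius x₀ ≠ 0)
    {δ : ℝ} (hδ : 0 < δ) :
    0 < μH[1] ((fun θ : ℝ => rotZ θ x₀) '' Ioo (-δ) δ) := by
  have hiso : Isometry (fun x : EuclideanSpace ℝ (Fin 3) => (((0 : ℝ), x) : ℝ × EuclideanSpace ℝ (Fin 3))) :=
    Isometry.of_dist_eq fun x y => by simp [Prod.dist_eq]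
  have h := hausdorffMeasure_rotZ_arc_pos hx 0 hδ
  have e : (fun θ : ℝ => (((0 : ℝ), rotZ θ x₀) : ℝ × EuclideanSpace ℝ (Fin 3))) '' Ioo (-δ) δ =
      (fun x : EuclideanSpace ℝ (Fin 3) => (((0 : ℝ), x) : ℝ × EuclideanSpace ℝ (Fin 3))) ''
        ((fun θ : ℝ => rotZ θ x₀) '' Ioo (-δ) δ) := by
    rw [Set.image_image]
  rwa [e, hiso.hausdorffMeasure_image (Or.inl zero_le_one)] at h

namespace ClayBlowup

variable {ν : ℝ} (X : ClayBlowup ν)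

/-! ## §2 Backward boundedness rotates with the symmetry -/

/-- **The slices of a Clay blow-up with axisymmetric datum and axisymmetric force are axisymmetric**
on `[0, T)` (the lean lineage's heredity theorem `DesignedBlowup.isAxisymmetric`, through
`toDesignedBlowup`). [cite: SereginSverak2009, §3 (arXiv p. 9)] -/
theorem isAxisymmetric (hν : 0 < ν) (h0A : IsAxisymmetric (X.u 0))
    (hfA : ∀ t ∈ Ico 0 X.T, IsAxisymmetric (X.f t)) :
    ∀ t ∈ Ico 0 X.T, IsAxisymmetric (X.u t) :=
  (X.toDesignedBlowup hν).isAxisymmetric hν h0A hfA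

/-- **Backward boundedness at `(T, x₀)` rotates with the symmetry**: if the slices `u t`,
`0 ≤ t < T`, are axisymmetric and `u` is bounded on `(T - r², T) × B(x₀, r)`, then `u` is bounded on
`(T - r'², T) × B(R_θ x₀, r')`, `r' = min r √T` (so that only times `t ≥ 0` enter), since
`|u(t, x)| = |R_θ u(t, R_{-θ} x)| = |u(t, R_{-θ} x)|` and `R_{-θ}` maps `B(R_θ x₀, r')` onto `B(x₀, r')`.
[cite: SereginSverak2009, §3 (arXiv p. 9)] -/
theorem isBackwardBoundedAt_rotZ (hax : ∀ t ∈ Ico 0 X.T, IsAxisymmetric (X.u t))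
    {x₀ : EuclideanSpace ℝ (Fin 3)} (h : IsBackwardBoundedAt X.u X.T x₀) (θ : ℝ) :
    IsBackwardBoundedAt X.u X.T (rotZ θ x₀) := by
  have hT := X.T_pos
  obtain ⟨r, hr, C, hC⟩ := h
  set r' : ℝ := min r (Real.sqrt X.T) with hr'
  have hr'0 : 0 < r' := lt_min hr (Real.sqrt_pos.2 hT)
  have hr'r : r' ≤ r := min_le_left _ _
  have hr'sq : r' ^ 2 ≤ X.T := by
    calc r' ^ 2 ≤ Real.sqrt X.T ^ 2 := pow_le_pow_left₀ hr'0.le (min_le_right _ _) 2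
      _ = X.T := Real.sq_sqrt hT.le
  refine ⟨r', hr'0, C, fun t ht x hx => ?_⟩
  have ht0 : t ∈ Ico 0 X.T := ⟨by linarith [ht.1], ht.2⟩
  have htr : t ∈ Ioo (X.T - r ^ 2) X.T := by
    have : r' ^ 2 ≤ r ^ 2 := pow_le_pow_left₀ hr'0.le hr'r 2
    exact ⟨by linarith [ht.1], ht.2⟩
  -- `x = R_θ (R_{-θ} x)` and `R_{-θ} x ∈ B(x₀, r)`
  have ex : x = rotZ θ (rotZ (-θ) x) := by rw [← rotZ_add, add_neg_cancel, rotZ_zero]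
  have hy : rotZ (-θ) x ∈ ball x₀ r := by
    rw [mem_ball] at hx ⊢
    have e0 : x₀ = rotZ (-θ) (rotZ θ x₀) := by rw [← rotZ_add, neg_add_cancel, rotZ_zero]
    have hd : dist (rotZ (-θ) x) (rotZ (-θ) (rotZ θ x₀)) = dist x (rotZ θ x₀) := by
      rw [← rotZLIE_apply, ← rotZLIE_apply (-θ) (rotZ θ x₀), LinearIsometryEquiv.dist_map]
    rw [e0, hd]
    exact lt_of_lt_of_le hx hr'r
  have key : ‖X.u t x‖ = ‖X.u t (rotZ (-θ) x)‖ := by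
    conv_lhs => rw [ex]
    rw [hax t ht0 θ (rotZ (-θ) x), norm_rotZ]
  rw [key]
  exact hC t htr _ hy

/-! ## §3 The singular slice lies on the axis -/

/-- **A SINGULAR POINT OF THE FINAL SLICE OF AN AXISYMMETRIC CLAY BLOW-UP LIES ON THE AXIS**
(`ν > 0`; axisymmetric datum, force axisymmetric on `[0, T)`): if `u` is not backward bounded at
`(T, x₀)` then `cylRadius x₀ = 0`. Otherwise the orbit arc `{R_θ x₀ : |θ| < 1}` would consist of
singular points (`isBackwardBoundedAt_rotZ` with the angle `-θ`) and have positive `ℋ¹`-measure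
(`hausdorffMeasure_rotZ_arc_pos_space`), against `μH[1] S_T = 0`
(`hausdorffMeasure_one_singularSlice_eq_zero`). Caffarelli–Kohn–Nirenberg's circle argument at the
first blow-up time, with the Clay force. No named fact.
[cite: SereginSverak2009, §3 (arXiv p. 9)] [cite: CaffarelliKohnNirenberg1982, Theorem B (§6, p. 807)] -/
theorem cylRadius_eq_zero_of_not_isBackwardBoundedAt (hν : 0 < ν) (h0A : IsAxisymmetric (X.u 0))
    (hfA : ∀ t ∈ Ico 0 X.T, IsAxisymmetric (X.f t)) {x₀ : EuclideanSpace ℝ (Fin 3)}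
    (hx₀ : ¬ IsBackwardBoundedAt X.u X.T x₀) : cylRadius x₀ = 0 := by
  by_contra hρ
  have hax := X.isAxisymmetric hν h0A hfA
  -- the orbit arc consists of singular points
  have hA : (fun θ : ℝ => rotZ θ x₀) '' Ioo (-1) 1 ⊆
      {y : EuclideanSpace ℝ (Fin 3) | ¬ IsBackwardBoundedAt X.u X.T y} := by
    rintro _ ⟨θ, -, rfl⟩ hreg
    have key := X.isBackwardBoundedAt_rotZ hax hreg (-θ)
    rw [← rotZ_add, neg_add_cancel, rotZ_zero] at key
    exact hx₀ key
  exact (hausdorffMeasure_rotZ_arc_pos_space hρ one_pos).ne'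
    (measure_mono_null hA (X.hausdorffMeasure_one_singularSlice_eq_zero hν))

/-- **THE SINGULAR SLICE OF AN AXISYMMETRIC CLAY BLOW-UP LIES ON THE AXIS** (set form):
`{x₀ | ¬ IsBackwardBoundedAt u T x₀} ⊆ {x | cylRadius x = 0}`. No named fact.
[cite: SereginSverak2009, §3 (arXiv p. 9)] [cite: CaffarelliKohnNirenberg1982, Theorem B (§6, p. 807)] -/
theorem singularSlice_subset_axis (hν : 0 < ν) (h0A : IsAxisymmetric (X.u 0))
    (hfA : ∀ t ∈ Ico 0 X.T, IsAxisymmetric (X.f t)) :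
    {x₀ : EuclideanSpace ℝ (Fin 3) | ¬ IsBackwardBoundedAt X.u X.T x₀} ⊆
      {x : EuclideanSpace ℝ (Fin 3) | cylRadius x = 0} :=
  fun _ hx => X.cylRadius_eq_zero_of_not_isBackwardBoundedAt hν h0A hfA hx

/-- **OFF THE AXIS THE BLOW-UP IS INVISIBLE UP TO AND INCLUDING THE BLOW-UP TIME**: every point `x₀`
with `cylRadius x₀ ≠ 0` is backward bounded at `T` — `u` is bounded on some
`(T - r², T) × B(x₀, r)` (contrapositive of `cylRadius_eq_zero_of_not_isBackwardBoundedAt`;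
Seregin–Zajaczkowski / Seregin–Šverák: "all points `x' ≠ 0` are regular"). No named fact.
[cite: SereginSverak2009, §3 (arXiv p. 9)] -/
theorem isBackwardBoundedAt_of_cylRadius_ne_zero (hν : 0 < ν) (h0A : IsAxisymmetric (X.u 0))
    (hfA : ∀ t ∈ Ico 0 X.T, IsAxisymmetric (X.f t)) {x₀ : EuclideanSpace ℝ (Fin 3)}
    (hx₀ : cylRadius x₀ ≠ 0) : IsBackwardBoundedAt X.u X.T x₀ := by
  by_contra h
  exact hx₀ (X.cylRadius_eq_zero_of_not_isBackwardBoundedAt hν h0A hfA h)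

/-- **AN AXISYMMETRIC CLAY BLOW-UP HAS A SINGULAR POINT ON THE AXIS, INSIDE THE FAR-FIELD BALL**:
some `x₀` with `cylRadius x₀ = 0`, `|x₀| ≤ R` (the far-field radius of `exists_singularPoint`), at
which `u` is not backward bounded at `T`; and its whole singular slice is a nonempty compact
`ℋ¹`-null subset of the axis. No named fact.
[cite: SereginSverak2009, §3 (arXiv p. 9)] [cite: CaffarelliKohnNirenberg1982, Theorem B (§6, p. 807)] -/
theorem exists_singularPoint_on_axis (hν : 0 < ν) (h0A : IsAxisymmetric (X.u 0))
    (hfA : ∀ t ∈ Ico 0 X.T, IsAxisymmetric (X.f t)) :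
    (∃ R : ℝ, (∀ x₀ : EuclideanSpace ℝ (Fin 3), R < ‖x₀‖ → IsBackwardBoundedAt X.u X.T x₀) ∧
      ∃ x₀ : EuclideanSpace ℝ (Fin 3), ‖x₀‖ ≤ R ∧ cylRadius x₀ = 0 ∧
        ¬ IsBackwardBoundedAt X.u X.T x₀) ∧
    IsCompact {x₀ : EuclideanSpace ℝ (Fin 3) | ¬ IsBackwardBoundedAt X.u X.T x₀} ∧
      {x₀ : EuclideanSpace ℝ (Fin 3) | ¬ IsBackwardBoundedAt X.u X.T x₀} ⊆
        {x : EuclideanSpace ℝ (Fin 3) | cylRadius x = 0} ∧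
      μH[1] {x₀ : EuclideanSpace ℝ (Fin 3) | ¬ IsBackwardBoundedAt X.u X.T x₀} = 0 := by
  obtain ⟨R, hreg, x₀, hx₀R, hx₀⟩ := X.exists_singularPoint hν
  exact ⟨⟨R, hreg, x₀, hx₀R, X.cylRadius_eq_zero_of_not_isBackwardBoundedAt hν h0A hfA hx₀, hx₀⟩,
    (X.isCompact_singularSlice hν).1, X.singularSlice_subset_axis hν h0A hfA,
    X.hausdorffMeasure_one_singularSlice_eq_zero hν⟩

end ClayBlowup

namespace DesignedBlowup

variable {ν : ℝ} (D : DesignedBlowup ν)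

/-- **The singular slice of an axisymmetric designed blow-up lies on the axis** (`ν > 0`;
axisymmetric datum, force axisymmetric on `[0, T)`; `toClayBlowup`).
[cite: SereginSverak2009, §3 (arXiv p. 9)] [cite: CaffarelliKohnNirenberg1982, Theorem B (§6, p. 807)] -/
theorem singularSlice_subset_axis (hν : 0 < ν) (h0A : IsAxisymmetric (D.u 0))
    (hfA : ∀ t ∈ Ico 0 D.T, IsAxisymmetric (D.f t)) :
    {x₀ : EuclideanSpace ℝ (Fin 3) | ¬ IsBackwardBoundedAt D.u D.T x₀} ⊆
      {x : EuclideanSpace ℝ (Fin 3) | cylRadius x = 0} :=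
  D.toClayBlowup.singularSlice_subset_axis hν h0A hfA

/-- **Off the axis an axisymmetric designed blow-up is backward bounded at `T`** (`ν > 0`).
[cite: SereginSverak2009, §3 (arXiv p. 9)] -/
theorem isBackwardBoundedAt_of_cylRadius_ne_zero (hν : 0 < ν) (h0A : IsAxisymmetric (D.u 0))
    (hfA : ∀ t ∈ Ico 0 D.T, IsAxisymmetric (D.f t)) {x₀ : EuclideanSpace ℝ (Fin 3)}
    (hx₀ : cylRadius x₀ ≠ 0) : IsBackwardBoundedAt D.u D.T x₀ :=
  D.toClayBlowup.isBackwardBoundedAt_of_cylRadius_ne_zero hν h0A hfA hx₀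

/-- **An axisymmetric designed blow-up has a singular point on the axis inside the far-field ball,
and its singular slice is a nonempty compact `ℋ¹`-null subset of the axis** (`ν > 0`).
[cite: SereginSverak2009, §3 (arXiv p. 9)] [cite: CaffarelliKohnNirenberg1982, Theorem B (§6, p. 807)] -/
theorem exists_singularPoint_on_axis (hν : 0 < ν) (h0A : IsAxisymmetric (D.u 0))
    (hfA : ∀ t ∈ Ico 0 D.T, IsAxisymmetric (D.f t)) :
    (∃ R : ℝ, (∀ x₀ : EuclideanSpace ℝ (Fin 3), R < ‖x₀‖ → IsBackwardBoundedAt D.u D.T x₀) ∧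
      ∃ x₀ : EuclideanSpace ℝ (Fin 3), ‖x₀‖ ≤ R ∧ cylRadius x₀ = 0 ∧
        ¬ IsBackwardBoundedAt D.u D.T x₀) ∧
    IsCompact {x₀ : EuclideanSpace ℝ (Fin 3) | ¬ IsBackwardBoundedAt D.u D.T x₀} ∧
      {x₀ : EuclideanSpace ℝ (Fin 3) | ¬ IsBackwardBoundedAt D.u D.T x₀} ⊆
        {x : EuclideanSpace ℝ (Fin 3) | cylRadius x = 0} ∧
      μH[1] {x₀ : EuclideanSpace ℝ (Fin 3) | ¬ IsBackwardBoundedAt D.u D.T x₀} = 0 :=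
  D.toClayBlowup.exists_singularPoint_on_axis hν h0A hfA

end DesignedBlowup

end Summit.NavierStokesRegularity.FluidComputer

end
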